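import Summits.Langlands.Langlands.Statement
import Literature.NumberTheory.GaloisRepresentations.LocalGaloisGroupProofs
import Literature.NumberTheory.GaloisRepresentations.LocalGaloisGroupFrobeniusProofs
import Literature.NumberTheory.Automorphic.LocalConstantsProofs
import Literature.NumberTheory.Automorphic.LocalLanglandsGLProofs
import HarnessLib

/-!
# Route IrreducibilityBySelfDuality — `ReciprocityUpToIrreducibilityR` (stmt-Langlands-17925), line `Sketch`:
# reciprocity data EXIST, given the two printed local inputs (`--supports` file; no definitions)

The crux reads `∀ F, Nonempty (ReciprocityData F) ∧ ∀ Rec n > 0 hcpt, (A′) ∧ (B)`.  This module proves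
its NON-VACUITY conjunct `∀ F, Nonempty (ReciprocityData F)` from the two local inputs of the line,
taken as HYPOTHESES (so nothing unproved is used):

* (h1) over every non-archimedean local field `F` there is a system of local constants `𝓔` whose
  local Artin data are THE canonical ones at every finite extension `E/F` (Deligne 1973, Thm. 4.1
  and Thm. 6.5, for the Artin maps of local class field theory);
* (h2) the tree's named fact `localLanglands_gl` for every non-archimedean local field and every
  normalising pair `(d, 𝓔)` with `𝓔.artin F = d` (Harris–Taylor 2001, Thm. A; Henniart 2000).

Proof (`stub_nonempty_of_inputs`): fix a number field `F`; at each finite place `v` the completion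
`F_v` is a non-archimedean local field (accepted instance
`instIsNonarchimedeanLocalFieldAdicCompletion`).  Take `𝓔_v` from (h1), put `d_v := 𝓔_v.artin F_v`
(so that `LocalLanglandsDatum.eps_artin` is `rfl`), take `rec_v` with `IsLocalLanglandsGL …` from
(h2), and thread the six `LocalGaloisGroup`/`LocalConstants` named facts through their PROVED
discharges `IsFrobPow.mul_holds`, `IsFrobPow.unique_holds`, `absInertia_normal_holds`,
`exists_isFrobPow_holds`, `WeilGroup.exists_subgroup_le_inertia_isOpen_of_continuous_holds`,
`isOpen_ker_quasiChar_holds`.  The two pins `llc_isCanonical`, `llc_eps_isCanonical` of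
`ReciprocityData` are (h1) at `E = F_v` and at `E` respectively.  Standard axioms only.
-/

noncomputable section

set_option linter.dupNamespace false

open scoped MatrixGroups NumberField
open IsDedekindDomain Filter
open Literature.NumberTheory.Automorphic Literature.NumberTheory.GaloisRepresentations
open Summit.Langlands

namespace Summit.Langlands.Langlands.Theorems.ReciprocityUpToIrreducibilityR

/-- **Reciprocity data exist, given the two local inputs.**  If (h1) every non-archimedean local
field carries a system of local constants whose Artin data are canonical at every finite
extension, and (h2) the local Langlands correspondence for `GL_n` (`localLanglands_gl`) holds for
every non-archimedean local field and every normalising pair, then every number field `F` carries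
a `ReciprocityData F`: at each completion `F_v` take `𝓔_v` from (h1), `d_v := 𝓔_v.artin F_v`,
`rec_v` from (h2), and the six threaded named facts from their proved discharges.
[cite: HarrisTaylorAMS2001, Thm. A] -/
theorem stub_nonempty_of_inputs :
    (∀ (F : Type) [Field F] [ValuativeRel F] [TopologicalSpace F] [IsNonarchimedeanLocalField F],
      ∃ 𝓔 : LocalEpsilonSystem F, ∀ (E : Type) [Field E] [ValuativeRel E] [TopologicalSpace E]
        [IsNonarchimedeanLocalField E] [Algebra F E] [FiniteDimensional F E], (𝓔.artin E).IsCanonical) →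
    (∀ (F : Type) [Field F] [ValuativeRel F] [TopologicalSpace F] [IsNonarchimedeanLocalField F]
      (hmul : IsFrobPow.mul (F := F)) (huniq : IsFrobPow.unique (F := F))
      (hn : absInertia_normal F) (hex : exists_isFrobPow (F := F))
      (hns : WeilGroup.exists_subgroup_le_inertia_isOpen_of_continuous (F := F))
      (d : LocalArtinData F) (𝓔 : LocalEpsilonSystem F) (hd : 𝓔.artin F = d),
      localLanglands_gl F hmul huniq hn hex hns d 𝓔 hd) →
    ∀ (F : Type) [Field F] [NumberField F], Nonempty (ReciprocityData F) := by
  intro h1 h2 F _ _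
  -- at each finite place: a local Langlands datum with both pins
  have key : ∀ v : HeightOneSpectrum (𝓞 F), ∃ L : LocalLanglandsDatum (v.adicCompletion F),
      L.artin.IsCanonical ∧ ∀ (E : Type) [Field E] [ValuativeRel E] [TopologicalSpace E]
        [IsNonarchimedeanLocalField E] [Algebra (v.adicCompletion F) E]
        [FiniteDimensional (v.adicCompletion F) E], (L.eps.artin E).IsCanonical := by
    intro v
    obtain ⟨𝓔, h𝓔⟩ := h1 (v.adicCompletion F)
    obtain ⟨rec, hrec, -⟩ := h2 (v.adicCompletion F) IsFrobPow.mul_holds IsFrobPow.unique_holds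
      (absInertia_normal_holds _) (exists_isFrobPow_holds _)
      WeilGroup.exists_subgroup_le_inertia_isOpen_of_continuous_holds _ 𝓔 rfl
    exact ⟨⟨IsFrobPow.mul_holds, IsFrobPow.unique_holds, absInertia_normal_holds _,
        exists_isFrobPow_holds _, WeilGroup.exists_subgroup_le_inertia_isOpen_of_continuous_holds,
        isOpen_ker_quasiChar_holds, _, 𝓔, rfl, rec, hrec⟩,
      h𝓔 (v.adicCompletion F), fun E _ _ _ _ _ _ => h𝓔 E⟩
  choose L hL hLE using key
  exact ⟨⟨L, hL, fun v E _ _ _ _ _ _ => hLE v E⟩⟩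

end Summit.Langlands.Langlands.Theorems.ReciprocityUpToIrreducibilityR

end
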